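import Mathlib
import Summits.MatrixMultiplication.MatrixMultiplication.Theses.LevelGradedCohnUmans
import Summits.MatrixMultiplication.MatrixMultiplication.Theorems.LevelGradedCohnUmansSnLevelDesignsStubFirstRowHooks
import Summits.MatrixMultiplication.MatrixMultiplication.Theorems.LevelGradedCohnUmansSnLevelDesignsStubNearWallGlue

/-!
# `SnLevelDesigns` (stmt-MatrixMultiplication-7613), line `fixed-set-certificates`: stub `stub_dimensionDecay` — level-`k` dimension decay

Crux `Summit.MatrixMultiplication.MatrixMultiplication.Theses.LevelGradedCohnUmans.SnLevelDesigns`; skeleton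
`Cruxes/SnLevelDesigns/Lines/fixed_set_certificates.lean` (4 registered stubs); this file proves the registered
stub `stub_dimensionDecay` verbatim (name + signature, tree-only vocabulary) and lands
`--supports stmt-MatrixMultiplication-7613`.

Statement (the analytic heart of the line's `ε`-bookkeeping): there are `c > 0` and `k₁` such that for
`k ≥ k₁`, `n ≥ k²` and every `μ ⊢ n` with `μ₁ ≥ n - k`,
`f^μ ≤ e^{-c√k} · √(D_k(n))`, where `D_k(n) = ∑_{ν₁ ≥ n-k} (f^ν)²` (written with the real exponent
`(f^ν : ℝ) ^ (2 : ℝ)`).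

Proof: a corollary of the sibling `garnir-annihilator` line, both of whose ingredients are landed theorems of
this namespace: `stub_firstRowHooks` (the two first-row hook bounds) feeds `nw_decay`, giving `c > 0`, `k₁`
with `(f^μ)² ≤ e^{2 - c√k} · D_k(n)` for `k ≥ k₁`, `3k ≤ n`, `μ₁ ≥ n - k`.  Answer with `c/4` and
`max k₁ (max 3 K)`, `K := ⌈(4/c)²⌉₊` (`dd_exists_threshold`: `c√k ≥ 4` for `k ≥ K`): for `k ≥ 3`,
`3k ≤ k² ≤ n`; the real sum equals the cast of the natural one (`dd_sum_rpow_two_eq`, `Real.rpow_two`);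
and `f = √(f²) ≤ √(e^{2-c√k} D) = e^{1 - c√k/2} √D ≤ e^{-(c/4)√k} √D` since `1 - c√k/2 ≤ -(c/4)√k` iff
`c√k ≥ 4`.
-/

set_option linter.dupNamespace false

namespace Summit.MatrixMultiplication.MatrixMultiplication.Theorems.SnLevelDesigns

open scoped BigOperators
open Literature.NumberTheory.DiophantineGeometry (numStandardTableaux)

/-- The level-`k` dimension sum written with the real exponent `(2 : ℝ)` is the cast of the natural-number
level sum `∑_{ν₁ ≥ n-k} (f^ν)²` (`Real.rpow_two`, `push_cast`). -/
theorem dd_sum_rpow_two_eq (n k : ℕ) :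
    (∑ ν : Nat.Partition n,
        if n - k ≤ ν.parts.sup then (numStandardTableaux ν : ℝ) ^ (2 : ℝ) else 0) =
      ((∑ ν : Nat.Partition n, if n - k ≤ ν.parts.sup then
          numStandardTableaux ν ^ 2 else 0 : ℕ) : ℝ) := by
  rw [Nat.cast_sum]
  refine Finset.sum_congr rfl fun ν _ => ?_
  rw [Nat.cast_ite, Nat.cast_pow, Nat.cast_zero, Real.rpow_two]

/-- Threshold: for `c > 0` there is `K` (namely `⌈(4/c)²⌉₊`) with `4 ≤ c · √k` for all `k ≥ K`. -/
theorem dd_exists_threshold {c : ℝ} (hc : 0 < c) :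
    ∃ K : ℕ, ∀ k : ℕ, K ≤ k → 4 ≤ c * Real.sqrt k := by
  refine ⟨⌈(4 / c) ^ 2⌉₊, fun k hk => ?_⟩
  have h1 : (4 / c) ^ 2 ≤ (k : ℝ) := (Nat.le_ceil _).trans (by exact_mod_cast hk)
  have h2 : 4 / c ≤ Real.sqrt k := by
    rw [show (4 / c : ℝ) = Real.sqrt ((4 / c) ^ 2) from (Real.sqrt_sq (by positivity)).symm]
    exact Real.sqrt_le_sqrt h1
  calc (4 : ℝ) = c * (4 / c) := by field_simp
    _ ≤ c * Real.sqrt k := mul_le_mul_of_nonneg_left h2 hc.le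

/-- **`stub_dimensionDecay`** (registered stub of crux stmt-MatrixMultiplication-7613, line
`fixed-set-certificates`): there are `c > 0` and `k₁` such that for `k ≥ k₁`, `n ≥ k²` and every
`μ ⊢ n` with `μ₁ ≥ n - k`, `f^μ ≤ e^{-c√k} · √(∑_{ν₁ ≥ n-k} (f^ν)²)`.  Corollary of
`nw_decay stub_firstRowHooks.1 stub_firstRowHooks.2` (`(f^μ)² ≤ e^{2-c√k} D_k(n)` for `3k ≤ n`) with the
constant `c/4` and the threshold `max k₁ (max 3 ⌈(4/c)²⌉₊)`. -/
theorem stub_dimensionDecay :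
    ∃ c : ℝ, 0 < c ∧ ∃ k₁ : ℕ, ∀ k : ℕ, k₁ ≤ k → ∀ n : ℕ, k ^ 2 ≤ n → ∀ μ : Nat.Partition n,
      n - k ≤ μ.parts.sup →
        (Literature.NumberTheory.DiophantineGeometry.numStandardTableaux μ : ℝ) ≤ Real.exp (-(c * Real.sqrt (k : ℝ))) *
          Real.sqrt (∑ ν : Nat.Partition n,
            if n - k ≤ ν.parts.sup then (Literature.NumberTheory.DiophantineGeometry.numStandardTableaux ν : ℝ) ^ (2 : ℝ) else 0) := by
  obtain ⟨c, hc, k₁, hk₁⟩ := nw_decay stub_firstRowHooks.1 stub_firstRowHooks.2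
  obtain ⟨K, hK⟩ := dd_exists_threshold hc
  refine ⟨c / 4, by positivity, max k₁ (max 3 K), fun k hk n hn μ hμ => ?_⟩
  have hk1 : k₁ ≤ k := le_trans (le_max_left _ _) hk
  have hk3 : 3 ≤ k := le_trans (le_trans (le_max_left _ _) (le_max_right _ _)) hk
  have hkK : K ≤ k := le_trans (le_trans (le_max_right _ _) (le_max_right _ _)) hk
  have h3k : 3 * k ≤ n :=
    calc 3 * k ≤ k * k := Nat.mul_le_mul_right _ hk3
      _ = k ^ 2 := (sq k).symm
      _ ≤ n := hn
  have hdec := hk₁ k hk1 n h3k μ hμ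
  rw [dd_sum_rpow_two_eq n k]
  have hf0 : (0 : ℝ) ≤ numStandardTableaux μ := Nat.cast_nonneg _
  -- `e^{2 - c√k} = (e^{1 - c√k/2})²`
  have hE : Real.exp (2 - c * Real.sqrt k) = Real.exp (1 - c * Real.sqrt k / 2) ^ 2 := by
    rw [← Real.exp_nat_mul]
    congr 1
    push_cast
    ring
  -- `1 - c√k/2 ≤ -(c/4)√k` from `c√k ≥ 4`
  have hle : 1 - c * Real.sqrt k / 2 ≤ -(c / 4 * Real.sqrt k) := by
    have h4 := hK k hkK
    linarith
  calc (numStandardTableaux μ : ℝ)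
      = Real.sqrt ((numStandardTableaux μ : ℝ) ^ 2) := (Real.sqrt_sq hf0).symm
    _ ≤ Real.sqrt (Real.exp (2 - c * Real.sqrt k) *
          ((∑ ν : Nat.Partition n, if n - k ≤ ν.parts.sup then
              numStandardTableaux ν ^ 2 else 0 : ℕ) : ℝ)) := Real.sqrt_le_sqrt hdec
    _ = Real.exp (1 - c * Real.sqrt k / 2) *
          Real.sqrt ((∑ ν : Nat.Partition n, if n - k ≤ ν.parts.sup then
              numStandardTableaux ν ^ 2 else 0 : ℕ) : ℝ) := by
        rw [hE, Real.sqrt_mul (sq_nonneg _), Real.sqrt_sq (Real.exp_pos _).le]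
    _ ≤ Real.exp (-(c / 4 * Real.sqrt k)) *
          Real.sqrt ((∑ ν : Nat.Partition n, if n - k ≤ ν.parts.sup then
              numStandardTableaux ν ^ 2 else 0 : ℕ) : ℝ) :=
        mul_le_mul_of_nonneg_right (Real.exp_le_exp.mpr hle) (Real.sqrt_nonneg _)

end Summit.MatrixMultiplication.MatrixMultiplication.Theorems.SnLevelDesigns
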